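/-
Origin: expansion seat `planner-pub-hodgecm-mc-axioms-1-g14-0`, handover #W215 2026-08-20T15:53:55Z md5 952c5663763e (PKG 0e0898461ca3 → 952c5663763e; 280 l.; MECHANICAL (iib-R) rewrite v3.1 of the PKG file as it stands (10 token edits; rules R1x1+RX[h₂]x9)) (`HOME/mc/pub-hodgecm-mc-axioms-1-g14/revendor/kit-r55/stage55/HodgeCM/Model/Binders/Real34TauTensor.lean`, md5 952c5663763e, 280 lines);
landed by the gen-22 packager (p-g22) in gate run 55 REPLACES the earlier landed copy of `HodgeCM/Model/Binders/Real34TauTensor.lean` (seat copy carried the packager Origin header of an earlier run (stripped)).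
-/
/-
Origin: speedrun cell pub-hodgecm, MODEL-CONSTRUCTION sub-cell, unit pub-hodgecm-mc-binder-1-g12 (BINDER PROVER, gen 12; row 17 `real34`:
the pure-tensor shape of the (34) see-saw tensor `tau34` — `htau`/`hTf` of `Real34CensusSideT.ofTensorDecomp` DISCHARGED), seat
prover-pub-hodgecm-mc-binder-1-g12-0, 2026-08-20.  Target in PKG: HodgeCM/Model/Binders/Real34TauTensor.lean (NEW additive leaf; imports RUN-48 #54
`Binders/Real34ConcreteIns` + the vendored tree modules `Weil1964/AdelicMetaplecticThetaMajorants` (stripping pattern),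
`Weil1964/AdelicMetaplecticReindex` (`piSBReindex_tmul`), `Automorphic/AdelicSchwartzBruhatDirectSumPure` (`tensorToSum_tmul`)).  KERNEL ONLY: theorems +
1 def-valued constructor; 0 records, nothing cited, 0 `def … : Prop`; MODEL-N ±0; E unchanged.  Nothing here is a claim of the manuscripts under adjudication.
-/
import Summits.HodgeConjecture.HodgeCM.Model.Binders.Real34ConcreteIns
import Literature.NumberTheory.Weil1964.AdelicMetaplecticThetaMajorants
import Literature.NumberTheory.Weil1964.AdelicMetaplecticReindex
import Literature.NumberTheory.Automorphic.AdelicSchwartzBruhatDirectSumPure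

/-!
# `tau34` is a pure-tensor bilinear map with a surjective finite part

Period-1's (34) see-saw tensor `tau34 V S = cmConjLineTensorFin … S.isoGL` (`Model/ArchSideTerm`) unfolds (`rfl`) to
`(φ₂, φ₃) ↦ R_{e_W} (ω(q₀) (R_{e_⊕}⁻¹ (R_{e₁}⁻¹ φ₂ ⊠ R_{e₁}⁻¹ φ₃)))` with ONE continuous adelic metaplectic element `q₀` (the rational
see-saw element lifted, tree `seesawConjTensor_apply`).  Every stage is a pure-tensor operator on pure tensors `Φ_∞ ⊗ Φ_f`:
the reindexings (`piSBReindex_tmul`), `⊠` (`tensorToSum_tmul`, finite part `finSumEquiv`), and `ω(q₀)` (Weil's stripping n° 37–38: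
`exists_finImplementer` + `exists_continuousLinearEquiv_map_tmul_of_mem_adelicMpCont` give `ω(q₀) (Φ_∞ ⊗ Φ_f) = A Φ_∞ ⊗ M_f Φ_f`
with `A`, `M_f` linear EQUIVALENCES).  Hence:

* § 1 `exists_omega_tmul` — `ω(q) (Φ_∞ ⊗ Φ_f) = A Φ_∞ ⊗ M_f Φ_f` for every `q ∈ Mp_ψ(W_𝔸)ᶜᵒⁿᵗ` (the tree's pattern, packaged);
  `exists_reindex_omega_tensorToSum_tmul` — the generic composite `R_{e_W} ∘ ω(q) ∘ R_e⁻¹ ∘ ⊠ ∘ (R_{e₁}⁻¹ × R_{e₂}⁻¹)` has the pure-tensor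
  shape `Tinf Φ₂ Φ₃ ⊗ Tf F₂ F₃` with `Tf` bilinear and `span (range ↿Tf) = ⊤` (its values are the images of ALL pure tensors under a linear
  equivalence);
* § 2 **`exists_tau34_tmul V S`**: `∃ Tinf Tf, (∀ Φ₂ Φ₃ F₂ F₃, tau34 V S (E₃ (Φ₂ ⊗ F₂)) (E₃ (Φ₃ ⊗ F₃)) = E₆ (Tinf Φ₂ Φ₃ ⊗ Tf F₂ F₃)) ∧
  span (range ↿Tf) = ⊤` — the hypotheses `htau`, `hTf` of RUN-48 #53/#54;
* § 3 (guarded pins) **`Real34CensusSideT.ofConcreteTau`** — #54 `ofConcreteIns` with `htau`/`hTf` folded into ONE existential archimedean statement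
  `harch : ∃ Tinf Tf, (pure-tensor shape of tau34 through Tinf, Tf) ∧ span (range ↿Tf) = ⊤ ∧ ∃ a, archVec₃₄ … φ₀ = a • (Tinf (Z₂ e₀^∨) (Z₃ e₁^∨) − Tinf (Z₂ e₁^∨) (Z₃ e₀^∨))`
  (§ 2 shows the first two conjuncts are satisfiable; the prover of `harch` may use ANY explicit factorisation).
-/

set_option autoImplicit false

noncomputable section

open MeasureTheory NumberField MulAction IsDedekindDomain
open scoped NumberField
open scoped Matrix Kronecker InnerProductSpace TensorProduct Classical

attribute [-instance] Quotient.instMeasurableSpace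

namespace HodgeCM.Model

open Literature.NumberTheory.Weil1964 Literature.NumberTheory.Automorphic Literature.NumberTheory.Automorphic.UnitaryGroup
open Literature.RepresentationTheory.HeisenbergGroup

/-! ## 1. Pure-tensor shape of `ω(q)` and of the reindexed see-saw composite -/

section Generic

variable {F : Type} [Field F] [NumberField F]

/-- **Weil's stripping, packaged**: every operator `ω(q)`, `q ∈ Mp_ψ(W_𝔸)ᶜᵒⁿᵗ` (invertible Gram matrix), is `A ⊗ M_f` on pure tensors,
with `A` a continuous linear automorphism of `𝓢(F_∞^ι)` and `M_f` a linear automorphism of `FinSB F ι` (tree `exists_finImplementer`,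
`exists_continuousLinearEquiv_map_tmul_of_mem_adelicMpCont`). -/
theorem exists_omega_tmul {ι : Type} [Fintype ι] [DecidableEq ι] {T : Matrix ι ι (AdeleRing (𝓞 F) F)} (hT : IsUnit T)
    (q : adelicMpCont F ι T) :
    ∃ (A : SchwartzMap (ι → mixedEmbedding.mixedSpace F) ℂ ≃L[ℂ] SchwartzMap (ι → mixedEmbedding.mixedSpace F) ℂ)
      (Mf : FinSB F ι ≃ₗ[ℂ] FinSB F ι),
      ∀ (Φ : SchwartzMap (ι → mixedEmbedding.mixedSpace F) ℂ) (f : FinSB F ι),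
        adelicMpCont.omega F ι T q (piSchwartzBruhatEquiv F ι (Φ ⊗ₜ f)) = piSchwartzBruhatEquiv F ι (A Φ ⊗ₜ Mf f) := by
  have hsurj : Function.Surjective fun y : ι → AdeleRing (𝓞 F) F => T *ᵥ y := mulVec_surjective_of_isUnit hT
  have homega : ∀ Φ, adelicMpCont.omega F ι T q Φ = ((q : adelicMp F ι T) :
      symplecticGroup (polar (adelicForm F ι T)) × (piSchwartzBruhat F ι ≃ₗ[ℂ] piSchwartzBruhat F ι)).2 Φ :=
    fun Φ => by rw [adelicMpCont.omega_apply, omegaPsi_apply]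
  have hexf := exists_finImplementer hsurj (q : adelicMp F ι T)
  rcases hexf with ⟨Mf, hMf⟩
  have hexA := exists_continuousLinearEquiv_map_tmul_of_mem_adelicMpCont hsurj (q : adelicMp F ι T) q.2 Mf hMf
  rcases hexA with ⟨A, hA⟩
  refine ⟨A, Mf, fun Φ f => ?_⟩
  rw [homega]
  exact (hA Φ f).1

/-- **The reindexed see-saw composite is a pure-tensor bilinear map with spanning finite values.**  For finite index types
`κ₁ κ₂ κ`, reindexings `e : κ ≃ κ₁ ⊕ κ₂`, `eW : κ ≃ ιW`, `e₁ : κ₁ ≃ ι₁`, `e₂ : κ₂ ≃ ι₂`, and `q ∈ Mp_ψ(W_𝔸)ᶜᵒⁿᵗ` over `κ`: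
`(φ₁, φ₂) ↦ R_{eW} (ω(q) (R_e⁻¹ (R_{e₁}⁻¹ φ₁ ⊠ R_{e₂}⁻¹ φ₂)))` sends `(E (Φ₁ ⊗ f₁), E (Φ₂ ⊗ f₂))` to `E (Tinf Φ₁ Φ₂ ⊗ Tf f₁ f₂)` with
`Tf` bilinear, `span (range ↿Tf) = ⊤`. -/
theorem exists_reindex_omega_tensorToSum_tmul {κ₁ κ₂ κ ι₁ ι₂ ιW : Type} [Fintype κ₁] [Fintype κ₂] [Fintype κ] [Fintype ι₁]
    [Fintype ι₂] [Fintype ιW] [DecidableEq κ] (e : κ ≃ κ₁ ⊕ κ₂) (eW : κ ≃ ιW) (e₁ : κ₁ ≃ ι₁) (e₂ : κ₂ ≃ ι₂)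
    {T : Matrix κ κ (AdeleRing (𝓞 F) F)} (hT : IsUnit T) (q : adelicMpCont F κ T) :
    ∃ (Tinf : SchwartzMap (ι₁ → mixedEmbedding.mixedSpace F) ℂ → SchwartzMap (ι₂ → mixedEmbedding.mixedSpace F) ℂ →
        SchwartzMap (ιW → mixedEmbedding.mixedSpace F) ℂ)
      (Tf : FinSB F ι₁ →ₗ[ℂ] FinSB F ι₂ →ₗ[ℂ] FinSB F ιW),
      (∀ (Φ₁ : SchwartzMap (ι₁ → mixedEmbedding.mixedSpace F) ℂ) (Φ₂ : SchwartzMap (ι₂ → mixedEmbedding.mixedSpace F) ℂ)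
          (f₁ : FinSB F ι₁) (f₂ : FinSB F ι₂),
        piSBReindex F eW (adelicMpCont.omega F κ T q ((piSBReindex F e).symm
          (tensorToSum F κ₁ κ₂ ((piSBReindex F e₁).symm (piSchwartzBruhatEquiv F ι₁ (Φ₁ ⊗ₜ f₁)))
            ((piSBReindex F e₂).symm (piSchwartzBruhatEquiv F ι₂ (Φ₂ ⊗ₜ f₂)))))) =
          piSchwartzBruhatEquiv F ιW (Tinf Φ₁ Φ₂ ⊗ₜ Tf f₁ f₂)) ∧
      Submodule.span ℂ (Set.range fun p : FinSB F ι₁ × FinSB F ι₂ => Tf p.1 p.2) = ⊤ := by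
  obtain ⟨A, Mf, hAM⟩ := exists_omega_tmul hT q
  -- the finite part: a linear equivalence after `(f₁, f₂) ↦ R f₁ ⊗ R f₂`
  let Lf : FinSB F κ₁ ⊗[ℂ] FinSB F κ₂ ≃ₗ[ℂ] FinSB F ιW :=
    (finSumEquiv F κ₁ κ₂).trans ((finSBReindex F e.symm).trans (Mf.trans (finSBReindex F eW)))
  let Tf : FinSB F ι₁ →ₗ[ℂ] FinSB F ι₂ →ₗ[ℂ] FinSB F ιW :=
    (TensorProduct.mk ℂ (FinSB F κ₁) (FinSB F κ₂)).compl₁₂ (finSBReindex F e₁.symm : FinSB F ι₁ →ₗ[ℂ] FinSB F κ₁)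
      (finSBReindex F e₂.symm : FinSB F ι₂ →ₗ[ℂ] FinSB F κ₂) |>.compr₂ (Lf : FinSB F κ₁ ⊗[ℂ] FinSB F κ₂ →ₗ[ℂ] FinSB F ιW)
  refine ⟨fun Φ₁ Φ₂ => schwartzReindexCLM F eW (A (schwartzReindexCLM F e.symm
      (archBoxTensor (schwartzReindexCLM F e₁.symm Φ₁) (schwartzReindexCLM F e₂.symm Φ₂)))), Tf, fun Φ₁ Φ₂ f₁ f₂ => ?_, ?_⟩
  · -- every stage is a pure-tensor operator; all equations fully instantiated (no rewriting inside the big goal)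
    have h1 : (piSBReindex F e₁).symm (piSchwartzBruhatEquiv F ι₁ (Φ₁ ⊗ₜ f₁)) =
        piSchwartzBruhatEquiv F κ₁ (schwartzReindexCLM F e₁.symm Φ₁ ⊗ₜ finSBReindex F e₁.symm f₁) :=
      piSBReindex_tmul F e₁.symm Φ₁ f₁
    have h2 : (piSBReindex F e₂).symm (piSchwartzBruhatEquiv F ι₂ (Φ₂ ⊗ₜ f₂)) =
        piSchwartzBruhatEquiv F κ₂ (schwartzReindexCLM F e₂.symm Φ₂ ⊗ₜ finSBReindex F e₂.symm f₂) :=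
      piSBReindex_tmul F e₂.symm Φ₂ f₂
    have h3 := tensorToSum_tmul (K := F) (schwartzReindexCLM F e₁.symm Φ₁) (finSBReindex F e₁.symm f₁)
      (schwartzReindexCLM F e₂.symm Φ₂) (finSBReindex F e₂.symm f₂)
    have inner : tensorToSum F κ₁ κ₂ ((piSBReindex F e₁).symm (piSchwartzBruhatEquiv F ι₁ (Φ₁ ⊗ₜ f₁)))
        ((piSBReindex F e₂).symm (piSchwartzBruhatEquiv F ι₂ (Φ₂ ⊗ₜ f₂))) =
        piSchwartzBruhatEquiv F (κ₁ ⊕ κ₂) (archBoxTensor (schwartzReindexCLM F e₁.symm Φ₁) (schwartzReindexCLM F e₂.symm Φ₂) ⊗ₜ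
          finSumEquiv F κ₁ κ₂ (finSBReindex F e₁.symm f₁ ⊗ₜ finSBReindex F e₂.symm f₂)) := by
      rw [h1, h2]; exact h3
    have h4 : (piSBReindex F e).symm (piSchwartzBruhatEquiv F (κ₁ ⊕ κ₂)
        (archBoxTensor (schwartzReindexCLM F e₁.symm Φ₁) (schwartzReindexCLM F e₂.symm Φ₂) ⊗ₜ
          finSumEquiv F κ₁ κ₂ (finSBReindex F e₁.symm f₁ ⊗ₜ finSBReindex F e₂.symm f₂))) = _ :=
      piSBReindex_tmul F e.symm (archBoxTensor (schwartzReindexCLM F e₁.symm Φ₁) (schwartzReindexCLM F e₂.symm Φ₂))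
        (finSumEquiv F κ₁ κ₂ (finSBReindex F e₁.symm f₁ ⊗ₜ finSBReindex F e₂.symm f₂))
    have h5 := hAM (schwartzReindexCLM F e.symm (archBoxTensor (schwartzReindexCLM F e₁.symm Φ₁) (schwartzReindexCLM F e₂.symm Φ₂)))
      (finSBReindex F e.symm (finSumEquiv F κ₁ κ₂ (finSBReindex F e₁.symm f₁ ⊗ₜ finSBReindex F e₂.symm f₂)))
    have h6 := piSBReindex_tmul F eW
      (A (schwartzReindexCLM F e.symm (archBoxTensor (schwartzReindexCLM F e₁.symm Φ₁) (schwartzReindexCLM F e₂.symm Φ₂))))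
      (Mf (finSBReindex F e.symm (finSumEquiv F κ₁ κ₂ (finSBReindex F e₁.symm f₁ ⊗ₜ finSBReindex F e₂.symm f₂))))
    exact (congrArg (fun x => piSBReindex F eW (adelicMpCont.omega F κ T q ((piSBReindex F e).symm x))) inner).trans
      ((congrArg (fun y => piSBReindex F eW (adelicMpCont.omega F κ T q y)) h4).trans
        ((congrArg (piSBReindex F eW) h5).trans h6))
  · -- `range Tf ⊇ Lf '' (pure tensors)`, and pure tensors span
    rw [eq_top_iff]
    rintro G -
    have hG : Lf.symm G ∈ Submodule.span ℂ {t : FinSB F κ₁ ⊗[ℂ] FinSB F κ₂ | ∃ a b, a ⊗ₜ b = t} := by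
      rw [TensorProduct.span_tmul_eq_top]; exact Submodule.mem_top
    have himg := Submodule.mem_map_of_mem (f := (Lf : FinSB F κ₁ ⊗[ℂ] FinSB F κ₂ →ₗ[ℂ] FinSB F ιW)) hG
    rw [LinearEquiv.coe_coe, LinearEquiv.apply_symm_apply, Submodule.map_span] at himg
    refine Submodule.span_mono ?_ himg
    rintro _ ⟨t, ⟨a, b, rfl⟩, rfl⟩
    refine ⟨(finSBReindex F e₁ a, finSBReindex F e₂ b), ?_⟩
    change Lf (finSBReindex F e₁.symm (finSBReindex F e₁ a) ⊗ₜ finSBReindex F e₂.symm (finSBReindex F e₂ b)) = Lf (a ⊗ₜ b)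
    congr 2
    · exact (finSBReindex F e₁).symm_apply_apply a
    · exact (finSBReindex F e₂).symm_apply_apply b

end Generic

/-! ## 2. `tau34` -/

section Tau

open Literature.NumberTheory.GelbartRogawski1991.UnitaryDualPair HodgeCM.Model.ArchSideTerm

variable {L : CMField} {ι₁ : L →+* ℂ} (V : HermSpace3 L ι₁) (S : StubTree.SeesawDatum L)

/-- **`tau34` is a pure-tensor bilinear map with spanning finite values** (`htau` + `hTf` of #53/#54). -/
theorem exists_tau34_tmul :
    ∃ (Tinf : SchwartzMap (Fin 3 → mixedEmbedding.mixedSpace ↥(maximalRealSubfield L)) ℂ →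
        SchwartzMap (Fin 3 → mixedEmbedding.mixedSpace ↥(maximalRealSubfield L)) ℂ →
          SchwartzMap (Fin 6 → mixedEmbedding.mixedSpace ↥(maximalRealSubfield L)) ℂ)
      (Tf : FinSB ↥(maximalRealSubfield L) (Fin 3) →ₗ[ℂ] FinSB ↥(maximalRealSubfield L) (Fin 3) →ₗ[ℂ] FinSB ↥(maximalRealSubfield L) (Fin 6)),
      (∀ (Φ₂ Φ₃ : SchwartzMap (Fin 3 → mixedEmbedding.mixedSpace ↥(maximalRealSubfield L)) ℂ) (F₂ F₃ : FinSB ↥(maximalRealSubfield L) (Fin 3)),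
        tau34 V S (piSchwartzBruhatEquiv ↥(maximalRealSubfield L) (Fin 3) (Φ₂ ⊗ₜ F₂))
            (piSchwartzBruhatEquiv ↥(maximalRealSubfield L) (Fin 3) (Φ₃ ⊗ₜ F₃)) =
          piSchwartzBruhatEquiv ↥(maximalRealSubfield L) (Fin 6) (Tinf Φ₂ Φ₃ ⊗ₜ Tf F₂ F₃)) ∧
      Submodule.span ℂ (Set.range fun p : FinSB ↥(maximalRealSubfield L) (Fin 3) × FinSB ↥(maximalRealSubfield L) (Fin 3) =>
        Tf p.1 p.2) = ⊤ :=
  exists_reindex_omega_tensorToSum_tmul (finProdSumEquiv 3 1 1) finProdFinEquiv ArchSideTerm.e₁ ArchSideTerm.e₁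
    (isUnit_kronecker_map (↥(maximalRealSubfield L)) 3 (isUnit_det_realDiagonal (L : Type) (frameD V) (frameD_real V) (frameD_ne V))
      (isUnit_det_realDiagonal (L : Type) (dW S) (dW_real S) (dW_ne S))) _

end Tau

/-! ## 3. At the guarded pins: `htau`/`hTf` discharged -/

open HodgeCM HodgeCM.Universe HodgeCM.Adelic HodgeCM.Model.HypCensus
open HodgeCM.PerL34 HodgeCM.PerL34.Fock HodgeCM.PerL34.Fock.PrintDict HodgeCM.PerL34.Annihilation
open Literature.NumberTheory.GelbartRogawski1991.UnitaryDualPair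
open Literature.AlgebraicGeometry.HodgeTheory
open Literature.AlgebraicGeometry.ShimuraVarieties
open Literature.NumberTheory.Automorphic.PicardCM
open Literature.NumberTheory.Transcendental (Arapura2012_Cor_15_4_6)
open HodgeCM.Model.ThetaSpace HodgeCM.Model.ArchSideTerm HodgeCM.Model.SupplyInstance HodgeCM.Model.SupplyResidual
open NumberField.SeesawArchTorus (toAdeles printedTorusHom printedTorusHom_apply placesEquiv)
open HodgeCM.PerL34.Fock.LocalFock NumberField.SeesawTorus NumberField.SeesawArchTorus

namespace Gen12PinsP

variable
  (G : ∀ {L : CMField} {ι₁ : L →+* ℂ} (_V : HermSpace3 L ι₁) (_c : SeesawCtx L), Prop)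
  (hG : ∀ {L : CMField} {ι₁ : L →+* ℂ} (V : HermSpace3 L ι₁) (c : SeesawCtx L),
    G V c → (∀ j, 0 < (ι₁ (dW c.D j)).re) ∨ ∀ j, (ι₁ (dW c.D j)).re < 0)
  (hGR : ∀ {L : CMField} {ι₁ : L →+* ℂ} (V : HermSpace3 L ι₁) (c : SeesawCtx L),
    (cmSplittingDatum (L : Type) finProdFinEquiv (frameD V) (frameD_real V) (frameD_ne V) (dW c.D) (dW_real c.D)
      (dW_ne c.D)).CompatibleSplitting)
  (η : ∀ {L : CMField} {ι₁ : L →+* ℂ} (V : HermSpace3 L ι₁) (c : SeesawCtx L),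
    CMAdelic (L : Type) (frameD V) × CMAdelic (L : Type) (dW c.D) →* ℂˣ)
  (hη : ∀ {L : CMField} {ι₁ : L →+* ℂ} (V : HermSpace3 L ι₁) (c : SeesawCtx L),
    ∀ γU ∈ CMRat (L : Type) (frameD V), ∀ γ ∈ CMRat (L : Type) (dW c.D), η V c (γU, γ) = 1)
  (hηc : ∀ {L : CMField} {ι₁ : L →+* ℂ} (V : HermSpace3 L ι₁) (c : SeesawCtx L), Continuous fun p => ((η V c p : ℂˣ) : ℂ))
  (hGR₀ : ∀ {L : CMField} {ι₁ : L →+* ℂ} (V : HermSpace3 L ι₁) (c : SeesawCtx L),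
    (cmSplittingDatum (L : Type) (e₁) (frameD V) (frameD_real V) (frameD_ne V) (lineVec (L : Type) (dW c.D 0))
      (fun _ => dW_real c.D 0) (fun _ => dW_ne c.D 0)).CompatibleSplitting)
  (hGR₁ : ∀ {L : CMField} {ι₁ : L →+* ℂ} (V : HermSpace3 L ι₁) (c : SeesawCtx L),
    (cmSplittingDatum (L : Type) (e₁) (frameD V) (frameD_real V) (frameD_ne V) (lineVec (L : Type) (dW c.D 1))
      (fun _ => dW_real c.D 1) (fun _ => dW_ne c.D 1)).CompatibleSplitting)
  (hGR₂ : ∀ {L : CMField} {ι₁ : L →+* ℂ} (V : HermSpace3 L ι₁) (c : SeesawCtx L),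
    (cmSplittingDatum (L : Type) (e₁) (frameD V) (frameD_real V) (frameD_ne V) (lineVec (L : Type) (dW' c.D 0))
      (fun _ => dW'_real c.D 0) (fun _ => dW'_ne c.D 0)).CompatibleSplitting)
  (hGR₃ : ∀ {L : CMField} {ι₁ : L →+* ℂ} (V : HermSpace3 L ι₁) (c : SeesawCtx L),
    (cmSplittingDatum (L : Type) (e₁) (frameD V) (frameD_real V) (frameD_ne V) (lineVec (L : Type) (dW' c.D 1))
      (fun _ => dW'_real c.D 1) (fun _ => dW'_ne c.D 1)).CompatibleSplitting)
  (AG : ∀ {L : CMField} {ι₁ : L →+* ℂ} (V : HermSpace3 L ι₁) (c : SeesawCtx L), G V c → ∀ k : Fin 4,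
    ArchLineInput V (lineRepD V c.D (hGR V c) (hGR₀ V c) (hGR₁ V c) (hGR₂ V c) (hGR₃ V c) (η V c) k))

variable (hHD : exists_isReal_hodgeModel) (hI : hodgePQ_independent_of_hodgeModel)
  (h₁ : BallQuotientUniformised)  (h₃ : CMAbelianVarietyRealised)
  (h : Bool) (hA : Arapura2012_Cor_15_4_6) (μ : ∀ {L : CMField}, SeesawCtx L → Fin 4 → InfinitePlace L → ℤ)

section Context34

variable {L : CMField} {ι₁ : L →+* ℂ} (V : HermSpace3 L ι₁) (c : SeesawCtx L) (hV : IsAnisotropic L V.Hm)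

/-- **`Real34CensusSideT` with `hins` DISCHARGED and `htau`/`hTf` folded into the archimedean statement.**  Inputs: the (34) census core with
its insertion identified with `ins₃₄` (`hcore`), LF-continuity of the two (34) pair actions, (W-0-supply), and `harch` in EXISTENTIAL form: SOME
pure-tensor factorisation `(Tinf, Tf)` of `tau34` (spanning finite values) under which `archVec₃₄ … φ₀` is a multiple of the letter wedge —
`exists_tau34_tmul` says such factorisations exist, so `harch` is the archimedean letter identity alone, provable with ANY explicit factorisation. -/
def Real34CensusSideT.ofConcreteTau (hW : IsAnisotropic L c.D.gramW) (hs : (∀ j, 0 < (ι₁ (dW c.D j)).re) ∨ ∀ j, (ι₁ (dW c.D j)).re < 0)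
    (jD : InfinitePlace (L : Type) → EqVar → Fin 6)
    (core : HypCoreW ((Gen12Pins.Wg @hGR @η @hη @hηc @Gen12Pins.τSyl @Gen12Pins.TSyl @Gen12Pins.hTSyl) V c) c.D.jT₃₄ (fun w => -μ c 2 w) (fun w => -μ c 3 w))
    (hcore : letI := core.decEq
      ∀ f : core.side.FinIdx, ∃ g : FinSB ↥(maximalRealSubfield L) (Fin 6),
        (core.side.ins f (printPlaces (InfinitePlace (L : Type)) core.kind core.lam core.hlam
            (pinnedVacs core.kind (fun w => -μ c 2 w) (fun w => -μ c 3 w))).φ₀ : piSchwartzBruhat (↥(maximalRealSubfield L)) (Fin 6)) =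
          ins₃₄ V c.D (hGR V c) (η V c) (datumAt V c.D jD (jIOf V c.D hs)) (fun w => -μ c 2 w) (fun w => -μ c 3 w) g
            (printedAt V c.D hs jD (fun w => -μ c 2 w) (fun w => -μ c 3 w)).φ₀)
    (Z₂ Z₃ : Module.Dual ℂ (thetaSpaceInputIn hHD hI h₁ h₃ ((SInstance.SGP @G @hG @hGR @η @hη @hηc @hGR₀ @hGR₁ @hGR₂ @hGR₃ @AG) V c) hV).W →ₗ[ℂ]
      SchwartzMap ((thetaSpaceInputIn hHD hI h₁ h₃ ((SInstance.SGP @G @hG @hGR @η @hη @hηc @hGR₀ @hGR₁ @hGR₂ @hGR₃ @AG) V c) hV).J →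
        mixedEmbedding.mixedSpace (thetaSpaceInputIn hHD hI h₁ h₃ ((SInstance.SGP @G @hG @hGR @η @hη @hηc @hGR₀ @hGR₁ @hGR₂ @hGR₃ @AG) V c) hV).K) ℂ)
    (hLF₂ : ((thetaSpaceInputIn hHD hI h₁ h₃ ((SInstance.SGP @G @hG @hGR @η @hη @hηc @hGR₀ @hGR₁ @hGR₂ @hGR₃ @AG) V c) hV).P 2).IsLFAction)
    (hLF₃ : ((thetaSpaceInputIn hHD hI h₁ h₃ ((SInstance.SGP @G @hG @hGR @η @hη @hηc @hGR₀ @hGR₁ @hGR₂ @hGR₃ @AG) V c) hV).P 3).IsLFAction)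
    (hsupply : ∀ (x₂ x₃ : Fin 3 → FiniteAdeleRing (𝓞 ↥(maximalRealSubfield L)) ↥(maximalRealSubfield L))
        (𝔫₂ 𝔫₃ : Ideal (𝓞 ↥(maximalRealSubfield L))),
      ∃ (B₂ : ArchKTypeDataAt (thetaSpaceInputIn hHD hI h₁ h₃ ((SInstance.SGP @G @hG @hGR @η @hη @hηc @hGR₀ @hGR₁ @hGR₂ @hGR₃ @AG) V c) hV) 2 x₂ 𝔫₂)
        (B₃ : ArchKTypeDataAt (thetaSpaceInputIn hHD hI h₁ h₃ ((SInstance.SGP @G @hG @hGR @η @hη @hηc @hGR₀ @hGR₁ @hGR₂ @hGR₃ @AG) V c) hV) 3 x₃ 𝔫₃),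
        B₃.Γ₀ = B₂.Γ₀ ∧ B₂.Φarch = Z₂ ∧ B₃.Φarch = Z₃ ∧
          B₂.IsWeaklyPDiff BallForms.expP ∧
          (∀ p : Fin 2, B₂.IsPMinusKilledAlong BallForms.expP (-Complex.I • (Pi.single p 1 : Fin 2 → ℂ))) ∧
          B₃.IsWeaklyPDiff BallForms.expP ∧
          (∀ p : Fin 2, B₃.IsPMinusKilledAlong BallForms.expP (-Complex.I • (Pi.single p 1 : Fin 2 → ℂ))))
    (harch : ∃ (Tinf : SchwartzMap (Fin 3 → mixedEmbedding.mixedSpace ↥(maximalRealSubfield L)) ℂ →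
        SchwartzMap (Fin 3 → mixedEmbedding.mixedSpace ↥(maximalRealSubfield L)) ℂ →
          SchwartzMap (Fin 6 → mixedEmbedding.mixedSpace ↥(maximalRealSubfield L)) ℂ)
        (Tf : FinSB ↥(maximalRealSubfield L) (Fin 3) →ₗ[ℂ] FinSB ↥(maximalRealSubfield L) (Fin 3) →ₗ[ℂ] FinSB ↥(maximalRealSubfield L) (Fin 6)),
      (∀ (Φ₂ Φ₃ : SchwartzMap (Fin 3 → mixedEmbedding.mixedSpace ↥(maximalRealSubfield L)) ℂ) (F₂ F₃ : FinSB ↥(maximalRealSubfield L) (Fin 3)),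
        tau34 V c.D (piSchwartzBruhatEquiv ↥(maximalRealSubfield L) (Fin 3) (Φ₂ ⊗ₜ F₂))
            (piSchwartzBruhatEquiv ↥(maximalRealSubfield L) (Fin 3) (Φ₃ ⊗ₜ F₃)) =
          piSchwartzBruhatEquiv ↥(maximalRealSubfield L) (Fin 6) (Tinf Φ₂ Φ₃ ⊗ₜ Tf F₂ F₃)) ∧
      Submodule.span ℂ (Set.range fun p : FinSB ↥(maximalRealSubfield L) (Fin 3) × FinSB ↥(maximalRealSubfield L) (Fin 3) =>
        Tf p.1 p.2) = ⊤ ∧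
      ∃ a : ℂ,
        archVec₃₄ V c.D (hGR V c) (η V c) (datumAt V c.D jD (jIOf V c.D hs)) (fun w => -μ c 2 w) (fun w => -μ c 3 w)
            (printedAt V c.D hs jD (fun w => -μ c 2 w) (fun w => -μ c 3 w)).φ₀ =
          a • (Tinf (Z₂ (LinearMap.proj 0)) (Z₃ (LinearMap.proj 1)) - Tinf (Z₂ (LinearMap.proj 1)) (Z₃ (LinearMap.proj 0)))) :
    Real34CensusSideT @G @hG @hGR @η @hη @hηc @hGR₀ @hGR₁ @hGR₂ @hGR₃ @AG hHD hI h₁ h₃ h hA @μ V c hV :=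
  Real34CensusSideT.ofConcreteIns @G @hG @hGR @η @hη @hηc @hGR₀ @hGR₁ @hGR₂ @hGR₃ @AG hHD hI h₁ h₃ h hA @μ V c hV hW hs jD core hcore
    Z₂ Z₃ hLF₂ hLF₃ hsupply (Classical.choose harch) (Classical.choose (Classical.choose_spec harch))
    (Classical.choose_spec (Classical.choose_spec harch)).1 (Classical.choose_spec (Classical.choose_spec harch)).2.1
    (Classical.choose_spec (Classical.choose_spec harch)).2.2

end Context34

end Gen12PinsP

end HodgeCM.Model

end
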